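import Literature.NumberTheory.Sieve.KloostermanQuintilinearSmooth
import Literature.NumberTheory.Sieve.KloostermanQuintilinearWeights2D
import Mathlib.Analysis.SpecialFunctions.Pow.Real
import HarnessLib

/-!
# The five-variable weights of Drappeau 2017, §5.5: the derivative hypothesis of Theorem 2.1

Topic `Literature/NumberTheory/Sieve`.  For the application of the quintilinear Kloosterman bound
(Drappeau 2017 Thm 2.1 ≡ Assing–Blomer–Li 2021 Thm 2.3, `a = 1`) in Drappeau 2017, §5.5 the weight
is separable up to the coupling in the two smooth variables:
`g(c,d,n,r,s) = A(c) B(d) P(κcd) · U(n) V(r) W(s)` (`A, B` pieces of `γ(q₀·)`, `P = α`-profile,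
`U, V, W` plateau cut-offs `≡ 1` on the support of the coefficients).  Combining
`mixedDeriv_mul_separable` (`KloostermanQuintilinearSmooth`), `norm_iteratedDeriv_cd_coupled_le`
(`…Weights2D`) and the pointwise calculus of `…DerivBounds`, this file proves the bound for all
mixed partial derivatives of such `g` and puts it in the form
`‖∂^ν g‖ ≤ K_ν (c^{-ν₀}d^{-ν₁}n^{-ν₂}r^{-ν₃}s^{-ν₄})^{1-ε₀}` required by the theorem, the losses
`x^{O(δ)}` of the rough cut-off `γ` (`Y = Sx^{-δ}`) in `c, d` being absorbed by `c^{ε₀}, d^{ε₀}`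
(Drappeau 2017, p. 20: "we are in a situation analogous to [BFI]"; the `ε₀` of Theorem 2.1).
Everything is proved; no definition, no named fact.

* `norm_mixedDeriv_separable_coupled_le` — the product bound
  `‖∂^ν g‖ ≤ XA XB MQ XU XV XW · ((LA+T)/c)^{ν₀} ((LB+1)/d)^{ν₁} (LU/n)^{ν₂} (LV/r)^{ν₃} (LW/s)^{ν₄}`;
* `pow_div_le_rpow_of_le` / `pow_div_le_rpow_of_ge` — absorbing the losses;
* `mixedDeriv_eq_zero_of_A`, `…_of_B` — vanishing below the supports in `c, d`;
* `norm_mixedDeriv_le_rpow` — the hypothesis of Theorem 2.1 / Theorem 2.3 for such `g`.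

## References

* S. Drappeau, Proc. London Math. Soc. (3) 114 (2017) 684–732, arXiv:1504.05549, Theorem 2.1
  (hypothesis (2.2)) and §5.5, p. 20. [cite: Drappeau2017, §5.5]
* E. Assing, V. Blomer, J. Li, Adv. Math. 393 (2021), arXiv:2005.13915, Theorem 2.3.
  [cite: AssingBlomerLi2020, Theorem 2.3]
-/

noncomputable section

open scoped ContDiff Topology
open Filter Finset

namespace Literature.NumberTheory.Sieve

namespace KloostermanQuintilinear

/-! ### The product bound -/

/-- **All mixed derivatives of `g = A(c)B(d)P(κcd)U(n)V(r)W(s)`**: with pointwise bounds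
`(XA k, LA/c)` for `A` at every `c > 0` (orders `≤ k`), similarly for `B, U, V, W`, and
`‖(t^m P^{(m)})^{(l)}‖ ≤ MQ k` (`m, l ≤ k`), `P = 0` on `[T₀, ∞)`, `0 ≤ T₀ < T`, `κ ≥ 0`:
`‖∂^ν g (c,d,n,r,s)‖ ≤ XA(ν₀)XB(ν₁)MQ(ν₀+ν₁)XU(ν₂)XV(ν₃)XW(ν₄) ·
  ((LA+T)/c)^{ν₀} ((LB+1)/d)^{ν₁} (LU/n)^{ν₂} (LV/r)^{ν₃} (LW/s)^{ν₄}`. [cite: Drappeau2017, §5.5] -/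
theorem norm_mixedDeriv_separable_coupled_le {A B P U V W : ℝ → ℂ} (hA : ContDiff ℝ ∞ A)
    (hB : ContDiff ℝ ∞ B) (hP : ContDiff ℝ ∞ P) {T₀ T : ℝ} (hT₀ : 0 ≤ T₀) (hT : T₀ < T)
    (hP0 : ∀ t, T₀ ≤ t → P t = 0) {MQ : ℕ → ℝ} (hMQ0 : ∀ k, 0 ≤ MQ k)
    (hMQ : ∀ k m l : ℕ, m ≤ k → l ≤ k → ∀ t : ℝ, ‖iteratedDeriv l (powDeriv P m) t‖ ≤ MQ k)
    {XA XB XU XV XW : ℕ → ℝ} (hXA : ∀ k, 0 ≤ XA k) (hXB : ∀ k, 0 ≤ XB k) {LA LB LU LV LW : ℝ}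
    (hLA : 0 ≤ LA) (hLB : 0 ≤ LB)
    (hAb : ∀ (k : ℕ) (c : ℝ), 0 < c → DerivBound A c k (XA k) (LA / c))
    (hBb : ∀ (k : ℕ) (d : ℝ), 0 < d → DerivBound B d k (XB k) (LB / d))
    (hUb : ∀ (k : ℕ) (n : ℝ), 0 < n → DerivBound U n k (XU k) (LU / n))
    (hVb : ∀ (k : ℕ) (r : ℝ), 0 < r → DerivBound V r k (XV k) (LV / r))
    (hWb : ∀ (k : ℕ) (s : ℝ), 0 < s → DerivBound W s k (XW k) (LW / s))
    {κ : ℝ} (hκ : 0 ≤ κ) (ν : Fin 5 → ℕ) {c d n r s : ℝ} (hc : 0 < c) (hd : 0 < d) (hn : 0 < n)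
    (hr : 0 < r) (hs : 0 < s) :
    ‖mixedDeriv ν (fun c' d' n' r' s' => A c' * B d' * P (κ * c' * d') * U n' * V r' * W s')
        c d n r s‖ ≤
      XA (ν 0) * XB (ν 1) * MQ (ν 0 + ν 1) * XU (ν 2) * XV (ν 3) * XW (ν 4) *
        (((LA + T) / c) ^ (ν 0) * ((LB + 1) / d) ^ (ν 1) * (LU / n) ^ (ν 2) * (LV / r) ^ (ν 3) *
          (LW / s) ^ (ν 4)) := by
  rw [mixedDeriv_mul_separable ν (fun c' d' => A c' * B d' * P (κ * c' * d')) U V W c d n r s,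
    norm_mul, norm_mul, norm_mul]
  have hF := norm_iteratedDeriv_cd_coupled_le hA hB hP hT₀ hT hP0 (ν 0) (ν 1) (hMQ0 (ν 0 + ν 1))
    (fun m hm l hl t => hMQ (ν 0 + ν 1) m l (by omega) (by omega) t) hκ hc hd (hXA (ν 0))
    (div_nonneg hLA hc.le) (hXB (ν 1)) (div_nonneg hLB hd.le) (hAb (ν 0) c hc) (hBb (ν 1) d hd)
  have hU' := (hUb (ν 2) n hn) (ν 2) le_rfl
  have hV' := (hVb (ν 3) r hr) (ν 3) le_rfl
  have hW' := (hWb (ν 4) s hs) (ν 4) le_rfl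
  have e1 : LA / c + T / c = (LA + T) / c := by ring
  have e2 : LB / d + d⁻¹ = (LB + 1) / d := by field_simp
  rw [e1, e2] at hF
  have h0F : 0 ≤ XA (ν 0) * XB (ν 1) * MQ (ν 0 + ν 1) * ((LA + T) / c) ^ ν 0 * ((LB + 1) / d) ^ ν 1 := by
    have : 0 ≤ (LA + T) / c := div_nonneg (by linarith [hT₀.trans hT.le]) hc.le
    have := hMQ0 (ν 0 + ν 1); have := hXA (ν 0); have := hXB (ν 1)
    positivity
  have hU0 : 0 ≤ XU (ν 2) * (LU / n) ^ ν 2 := (norm_nonneg _).trans hU'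
  have hV0 : 0 ≤ XV (ν 3) * (LV / r) ^ ν 3 := (norm_nonneg _).trans hV'
  calc _ ≤ (XA (ν 0) * XB (ν 1) * MQ (ν 0 + ν 1) * ((LA + T) / c) ^ ν 0 * ((LB + 1) / d) ^ ν 1) *
        ((XU (ν 2) * (LU / n) ^ ν 2) * (XV (ν 3) * (LV / r) ^ ν 3) * (XW (ν 4) * (LW / s) ^ ν 4)) := by
        refine mul_le_mul hF (mul_le_mul (mul_le_mul hU' hV' (norm_nonneg _) hU0) hW' (norm_nonneg _)
          (mul_nonneg hU0 hV0)) (by positivity) h0F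
    _ = _ := by ring

/-! ### Absorbing the losses -/

/-- Rough weights in a large variable: if `L ≤ Λ v^{ε₀}` then `(L/v)^m ≤ Λ^m (v^{-m})^{1-ε₀}`.
[folklore] -/
theorem pow_div_le_rpow_of_le {v L Λ ε₀ : ℝ} (hv : 0 < v) (hL : 0 ≤ L) (hΛ : L ≤ Λ * v ^ ε₀)
    (m : ℕ) : (L / v) ^ m ≤ Λ ^ m * (v ^ (-(m : ℝ))) ^ (1 - ε₀) := by
  have h1 : (L / v) ^ m ≤ (Λ * v ^ ε₀ / v) ^ m :=
    pow_le_pow_left₀ (div_nonneg hL hv.le) (div_le_div_of_nonneg_right hΛ hv.le) m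
  refine h1.trans (le_of_eq ?_)
  rw [div_pow, mul_pow, ← Real.rpow_natCast (v ^ ε₀), ← Real.rpow_mul hv.le,
    ← Real.rpow_natCast v, ← Real.rpow_mul hv.le, mul_div_assoc, ← Real.rpow_sub hv]
  congr 1
  ring_nf

/-- Smooth weights in a variable bounded below: for `v ≥ vmin > 0`, `0 ≤ ε₀ ≤ 1`,
`(L/v)^m ≤ (L / min 1 vmin)^m (v^{-m})^{1-ε₀}`. [folklore] -/
theorem pow_div_le_rpow_of_ge {v L vmin ε₀ : ℝ} (hvmin : 0 < vmin) (hv : vmin ≤ v) (hL : 0 ≤ L)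
    (hε₀ : 0 ≤ ε₀) (hε₁ : ε₀ ≤ 1) (m : ℕ) :
    (L / v) ^ m ≤ (L / min 1 vmin) ^ m * (v ^ (-(m : ℝ))) ^ (1 - ε₀) := by
  have hv0 : 0 < v := hvmin.trans_le hv
  have hmin0 : 0 < min 1 vmin := lt_min one_pos hvmin
  have hmin1 : min 1 vmin ≤ 1 := min_le_left _ _
  -- `(v^{-m})^{1-ε₀} = v^{-m} v^{m ε₀}` and `v^{m ε₀} ≥ (min 1 vmin)^m`
  have e : (v ^ (-(m : ℝ))) ^ (1 - ε₀) = (v ^ m)⁻¹ * v ^ ((m : ℝ) * ε₀) := by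
    rw [← Real.rpow_mul hv0.le, show -(m : ℝ) * (1 - ε₀) = -(m : ℝ) + (m : ℝ) * ε₀ by ring,
      Real.rpow_add hv0, Real.rpow_neg hv0.le, Real.rpow_natCast]
  rw [e]
  have hlow : (min 1 vmin) ^ m ≤ v ^ ((m : ℝ) * ε₀) := by
    by_cases h1 : 1 ≤ v
    · exact (pow_le_one₀ hmin0.le hmin1).trans (Real.one_le_rpow h1 (by positivity))
    · have hv1 : v ≤ 1 := le_of_not_ge h1
      calc (min 1 vmin) ^ m ≤ v ^ m := pow_le_pow_left₀ hmin0.le ((min_le_right _ _).trans hv) m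
        _ = v ^ ((m : ℝ) * 1) := by rw [mul_one, Real.rpow_natCast]
        _ ≤ v ^ ((m : ℝ) * ε₀) :=
            Real.rpow_le_rpow_of_exponent_ge hv0 hv1 (by nlinarith)
  have hpos : 0 < (min 1 vmin) ^ m := pow_pos hmin0 m
  calc (L / v) ^ m = L ^ m * (v ^ m)⁻¹ := by rw [div_pow, div_eq_mul_inv]
    _ = (L / min 1 vmin) ^ m * (v ^ m)⁻¹ * (min 1 vmin) ^ m := by
        rw [div_pow]; field_simp
    _ ≤ (L / min 1 vmin) ^ m * (v ^ m)⁻¹ * v ^ ((m : ℝ) * ε₀) :=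
        mul_le_mul_of_nonneg_left hlow (by positivity)
    _ = _ := by ring

/-! ### Vanishing below the supports in the smooth variables -/

/-- If `A` vanishes near `c`, all mixed derivatives of `A(c)B(d)P(κcd)U(n)V(r)W(s)` vanish at `c`.
[folklore] -/
theorem mixedDeriv_eq_zero_of_A {A B P U V W : ℝ → ℂ} {c : ℝ} (hAz : A =ᶠ[𝓝 c] 0) (κ : ℝ)
    (ν : Fin 5 → ℕ) (d n r s : ℝ) :
    mixedDeriv ν (fun c' d' n' r' s' => A c' * B d' * P (κ * c' * d') * U n' * V r' * W s')
      c d n r s = 0 := by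
  rw [mixedDeriv_mul_separable ν (fun c' d' => A c' * B d' * P (κ * c' * d')) U V W c d n r s]
  have hz : (fun c' => iteratedDeriv (ν 1) (fun d' => A c' * B d' * P (κ * c' * d')) d) =ᶠ[𝓝 c] 0 := by
    refine hAz.mono fun c' hc' => ?_
    have e : (fun d' => A c' * B d' * P (κ * c' * d')) = fun _ => 0 := by
      funext d'; rw [hc']; simp
    simp only [e, iteratedDeriv_fun_const_zero, Pi.zero_apply]
  rw [(hz.iteratedDeriv (ν 0)).eq_of_nhds]
  simp

/-- If `B` vanishes near `d`, all mixed derivatives of `A(c)B(d)P(κcd)U(n)V(r)W(s)` vanish at `d`.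
[folklore] -/
theorem mixedDeriv_eq_zero_of_B {A B P U V W : ℝ → ℂ} {d : ℝ} (hBz : B =ᶠ[𝓝 d] 0) (κ : ℝ)
    (ν : Fin 5 → ℕ) (c n r s : ℝ) :
    mixedDeriv ν (fun c' d' n' r' s' => A c' * B d' * P (κ * c' * d') * U n' * V r' * W s')
      c d n r s = 0 := by
  rw [mixedDeriv_mul_separable ν (fun c' d' => A c' * B d' * P (κ * c' * d')) U V W c d n r s]
  have hz : ∀ c' : ℝ, iteratedDeriv (ν 1) (fun d' => A c' * B d' * P (κ * c' * d')) d = 0 := by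
    intro c'
    have h : (fun d' => A c' * B d' * P (κ * c' * d')) =ᶠ[𝓝 d] 0 :=
      hBz.mono fun d' hd' => by simp [hd']
    rw [(h.iteratedDeriv (ν 1)).eq_of_nhds]
    simp
  simp only [hz, iteratedDeriv_fun_const_zero, zero_mul]

/-- A vanishing one-variable factor kills all mixed derivatives. [folklore] -/
theorem mixedDeriv_eq_zero_of_factor {A B P U V W : ℝ → ℂ} (κ : ℝ) (ν : Fin 5 → ℕ) {c d n r s : ℝ}
    (h : iteratedDeriv (ν 2) U n = 0 ∨ iteratedDeriv (ν 3) V r = 0 ∨ iteratedDeriv (ν 4) W s = 0) :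
    mixedDeriv ν (fun c' d' n' r' s' => A c' * B d' * P (κ * c' * d') * U n' * V r' * W s')
      c d n r s = 0 := by
  rw [mixedDeriv_mul_separable ν (fun c' d' => A c' * B d' * P (κ * c' * d')) U V W c d n r s]
  rcases h with h | h | h <;> simp [h]

/-- Derivatives of a function vanishing near a point vanish there. [folklore] -/
theorem iteratedDeriv_eq_zero_of_eventuallyEq {U : ℝ → ℂ} {n : ℝ} (h : U =ᶠ[𝓝 n] 0) (k : ℕ) :
    iteratedDeriv k U n = 0 := by
  rw [(h.iteratedDeriv k).eq_of_nhds]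
  exact iteratedDeriv_fun_const_zero

/-- A product of five inequalities between non-negative reals. [folklore] -/
private theorem prod5_le {a₁ a₂ a₃ a₄ a₅ b₁ b₂ b₃ b₄ b₅ : ℝ} (h₁ : a₁ ≤ b₁) (h₂ : a₂ ≤ b₂)
    (h₃ : a₃ ≤ b₃) (h₄ : a₄ ≤ b₄) (h₅ : a₅ ≤ b₅) (g₁ : 0 ≤ a₁) (g₂ : 0 ≤ a₂) (g₃ : 0 ≤ a₃)
    (g₄ : 0 ≤ a₄) (g₅ : 0 ≤ a₅) :
    a₁ * a₂ * a₃ * a₄ * a₅ ≤ b₁ * b₂ * b₃ * b₄ * b₅ :=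
  mul_le_mul (mul_le_mul (mul_le_mul (mul_le_mul h₁ h₂ g₂ (g₁.trans h₁)) h₃ g₃
    (mul_nonneg (g₁.trans h₁) (g₂.trans h₂))) h₄ g₄
    (mul_nonneg (mul_nonneg (g₁.trans h₁) (g₂.trans h₂)) (g₃.trans h₃))) h₅ g₅
    (mul_nonneg (mul_nonneg (mul_nonneg (g₁.trans h₁) (g₂.trans h₂)) (g₃.trans h₃)) (g₄.trans h₄))

/-- **The derivative hypothesis of Theorem 2.1 / Theorem 2.3 for the weights of Drappeau 2017, §5.5.**
Let `g = A(c)B(d)P(κcd)U(n)V(r)W(s)` be as in `norm_mixedDeriv_separable_coupled_le`, and suppose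
moreover: `A` vanishes near every `c < cmin`, `B` near every `d < dmin`, `U, V, W` near every
`n < nmin`, `r < rmin`, `s < smin` (`nmin, rmin, smin > 0`), and the losses in the two smooth variables are
absorbed by `ε₀`-powers: `LA + T ≤ Λ c^{ε₀}` for `c ≥ cmin` and `LB + 1 ≤ Λ d^{ε₀}` for
`d ≥ dmin` (`0 ≤ ε₀ ≤ 1`).  Then for all `ν` and all `c, d, n, r, s > 0`,
`‖∂^ν g‖ ≤ K_ν (c^{-ν₀} d^{-ν₁} n^{-ν₂} r^{-ν₃} s^{-ν₄})^{1-ε₀}` with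
`K_ν = XA(ν₀)XB(ν₁)MQ(ν₀+ν₁)XU(ν₂)XV(ν₃)XW(ν₄) · Λ^{ν₀+ν₁} (LU/min(1,nmin))^{ν₂}
  (LV/min(1,rmin))^{ν₃} (LW/min(1,smin))^{ν₄}` — a family depending on `ν` only, as Theorem 2.1
requires. [cite: Drappeau2017, Theorem 2.1 (2.2), §5.5 p. 20] [cite: AssingBlomerLi2020, Theorem 2.3] -/
theorem norm_mixedDeriv_le_rpow {A B P U V W : ℝ → ℂ} (hA : ContDiff ℝ ∞ A)
    (hB : ContDiff ℝ ∞ B) (hP : ContDiff ℝ ∞ P) {T₀ T : ℝ} (hT₀ : 0 ≤ T₀) (hT : T₀ < T)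
    (hP0 : ∀ t, T₀ ≤ t → P t = 0) {MQ : ℕ → ℝ} (hMQ0 : ∀ k, 0 ≤ MQ k)
    (hMQ : ∀ k m l : ℕ, m ≤ k → l ≤ k → ∀ t : ℝ, ‖iteratedDeriv l (powDeriv P m) t‖ ≤ MQ k)
    {XA XB XU XV XW : ℕ → ℝ} (hXA : ∀ k, 0 ≤ XA k) (hXB : ∀ k, 0 ≤ XB k) (hXU : ∀ k, 0 ≤ XU k)
    (hXV : ∀ k, 0 ≤ XV k) (hXW : ∀ k, 0 ≤ XW k) {LA LB LU LV LW : ℝ} (hLA : 0 ≤ LA) (hLB : 0 ≤ LB)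
    (hLU : 0 ≤ LU) (hLV : 0 ≤ LV) (hLW : 0 ≤ LW)
    (hAb : ∀ (k : ℕ) (c : ℝ), 0 < c → DerivBound A c k (XA k) (LA / c))
    (hBb : ∀ (k : ℕ) (d : ℝ), 0 < d → DerivBound B d k (XB k) (LB / d))
    (hUb : ∀ (k : ℕ) (n : ℝ), 0 < n → DerivBound U n k (XU k) (LU / n))
    (hVb : ∀ (k : ℕ) (r : ℝ), 0 < r → DerivBound V r k (XV k) (LV / r))
    (hWb : ∀ (k : ℕ) (s : ℝ), 0 < s → DerivBound W s k (XW k) (LW / s))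
    {κ : ℝ} (hκ : 0 ≤ κ)
    {ε₀ Λ cmin dmin nmin rmin smin : ℝ} (hε₀ : 0 ≤ ε₀) (hε₁ : ε₀ ≤ 1) (hΛ : 0 ≤ Λ)
    (hnmin : 0 < nmin) (hrmin : 0 < rmin) (hsmin : 0 < smin)
    (hAz : ∀ c : ℝ, 0 < c → c < cmin → A =ᶠ[𝓝 c] 0)
    (hBz : ∀ d : ℝ, 0 < d → d < dmin → B =ᶠ[𝓝 d] 0)
    (hUz : ∀ n : ℝ, 0 < n → n < nmin → U =ᶠ[𝓝 n] 0)
    (hVz : ∀ r : ℝ, 0 < r → r < rmin → V =ᶠ[𝓝 r] 0)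
    (hWz : ∀ s : ℝ, 0 < s → s < smin → W =ᶠ[𝓝 s] 0)
    (hΛc : ∀ c : ℝ, cmin ≤ c → LA + T ≤ Λ * c ^ ε₀)
    (hΛd : ∀ d : ℝ, dmin ≤ d → LB + 1 ≤ Λ * d ^ ε₀)
    (ν : Fin 5 → ℕ) {c d n r s : ℝ} (hc : 0 < c) (hd : 0 < d) (hn : 0 < n) (hr : 0 < r)
    (hs : 0 < s) :
    ‖mixedDeriv ν (fun c' d' n' r' s' => A c' * B d' * P (κ * c' * d') * U n' * V r' * W s')
        c d n r s‖ ≤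
      (XA (ν 0) * XB (ν 1) * MQ (ν 0 + ν 1) * XU (ν 2) * XV (ν 3) * XW (ν 4) *
        (Λ ^ (ν 0) * Λ ^ (ν 1) * (LU / min 1 nmin) ^ (ν 2) * (LV / min 1 rmin) ^ (ν 3) *
          (LW / min 1 smin) ^ (ν 4))) *
      (c ^ (-(ν 0 : ℝ)) * d ^ (-(ν 1 : ℝ)) * n ^ (-(ν 2 : ℝ)) * r ^ (-(ν 3 : ℝ)) *
        s ^ (-(ν 4 : ℝ))) ^ (1 - ε₀) := by
  -- the right-hand side is non-negative
  have hK0 : 0 ≤ XA (ν 0) * XB (ν 1) * MQ (ν 0 + ν 1) * XU (ν 2) * XV (ν 3) * XW (ν 4) *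
      (Λ ^ (ν 0) * Λ ^ (ν 1) * (LU / min 1 nmin) ^ (ν 2) * (LV / min 1 rmin) ^ (ν 3) *
        (LW / min 1 smin) ^ (ν 4)) := by
    have := hXA (ν 0); have := hXB (ν 1); have := hMQ0 (ν 0 + ν 1); have := hXU (ν 2)
    have := hXV (ν 3); have := hXW (ν 4)
    have : 0 < min 1 nmin := lt_min one_pos hnmin
    have : 0 < min 1 rmin := lt_min one_pos hrmin
    have : 0 < min 1 smin := lt_min one_pos hsmin
    positivity
  have hR0 : 0 ≤ (c ^ (-(ν 0 : ℝ)) * d ^ (-(ν 1 : ℝ)) * n ^ (-(ν 2 : ℝ)) * r ^ (-(ν 3 : ℝ)) *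
      s ^ (-(ν 4 : ℝ))) ^ (1 - ε₀) := by positivity
  -- below the supports everything vanishes
  by_cases hcc : c < cmin
  · rw [mixedDeriv_eq_zero_of_A (hAz c hc hcc) κ ν d n r s, norm_zero]; positivity
  by_cases hdd : d < dmin
  · rw [mixedDeriv_eq_zero_of_B (hBz d hd hdd) κ ν c n r s, norm_zero]; positivity
  by_cases hnn : n < nmin
  · rw [mixedDeriv_eq_zero_of_factor κ ν (Or.inl (iteratedDeriv_eq_zero_of_eventuallyEq
      (hUz n hn hnn) _)), norm_zero]; positivity
  by_cases hrr : r < rmin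
  · rw [mixedDeriv_eq_zero_of_factor κ ν (Or.inr (Or.inl (iteratedDeriv_eq_zero_of_eventuallyEq
      (hVz r hr hrr) _))), norm_zero]; positivity
  by_cases hss : s < smin
  · rw [mixedDeriv_eq_zero_of_factor κ ν (Or.inr (Or.inr (iteratedDeriv_eq_zero_of_eventuallyEq
      (hWz s hs hss) _))), norm_zero]; positivity
  rw [not_lt] at hcc hdd hnn hrr hss
  -- the product bound and the absorption of the losses
  have hPB := norm_mixedDeriv_separable_coupled_le hA hB hP hT₀ hT hP0 hMQ0 hMQ hXA hXB hLA hLB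
    hAb hBb hUb hVb hWb hκ ν hc hd hn hr hs
  have h1 := pow_div_le_rpow_of_le hc (by linarith [hT₀.trans hT.le]) (hΛc c hcc) (ν 0)
  have h2 := pow_div_le_rpow_of_le hd (by linarith) (hΛd d hdd) (ν 1)
  have h3 := pow_div_le_rpow_of_ge hnmin hnn hLU hε₀ hε₁ (ν 2)
  have h4 := pow_div_le_rpow_of_ge hrmin hrr hLV hε₀ hε₁ (ν 3)
  have h5 := pow_div_le_rpow_of_ge hsmin hss hLW hε₀ hε₁ (ν 4)
  have hT' : 0 ≤ LA + T := by linarith [hT₀.trans hT.le]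
  have hprod := prod5_le h1 h2 h3 h4 h5 (by positivity) (by positivity) (by positivity)
    (by positivity) (by positivity)
  refine hPB.trans ((mul_le_mul_of_nonneg_left hprod ?_).trans (le_of_eq ?_))
  · have := hXA (ν 0); have := hXB (ν 1); have := hMQ0 (ν 0 + ν 1)
    have := (norm_nonneg _).trans ((hUb (ν 2) n hn).norm_self_le)
    have := (norm_nonneg _).trans ((hVb (ν 3) r hr).norm_self_le)
    have := (norm_nonneg _).trans ((hWb (ν 4) s hs).norm_self_le)
    positivity
  · rw [Real.mul_rpow (by positivity) (by positivity), Real.mul_rpow (by positivity) (by positivity),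
      Real.mul_rpow (by positivity) (by positivity), Real.mul_rpow (by positivity) (by positivity)]
    ring

end KloostermanQuintilinear

end Literature.NumberTheory.Sieve

end
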